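import Mathlib
import Literature.Computability.AlgebraicComplexity.EquivariantDC
import Literature.Computability.AlgebraicComplexity.StandardFamilies
import Literature.Computability.AlgebraicComplexity.StandardFamiliesProofs
import Literature.Computability.AlgebraicComplexity.LRPencilOfMatrix
import Literature.Computability.AlgebraicComplexity.LRFullLifts
import Literature.Computability.AlgebraicComplexity.LRLiftCharacter

/-!
# Crux `OrbitDimensionBound` (stmt-ValiantsHypothesis-16133), line `affine_multiple` — registered stub `stub_cofactorShape`
# (forced semi-invariance: an affine cofactor of an equivariantly represented multiple `per_n · q` is constant or linear)

Route `ValiantsHypothesis/FreeSubtorus`, crux `OrbitDimensionBound` (stmt-ValiantsHypothesis-16133), registered skeleton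
`Cruxes/OrbitDimensionBound/Lines/affine_multiple.lean` (rung `Multiple.AffineMultipleShadow`; stubs `stub_cofactorShape`,
`stub_absorbingSacrifice`, `stub_perInvariantTorusBound`).  This file proves the statement `Stmt.stub_cofactorShape` of that
skeleton, spelled over the Theses-level INLINE form of the subtorus `T_Λ` and of admissibility (the skeleton's abbreviations
`torusGen n r Λ` / `Admissible n r Λ` live in `Cruxes/…/Lines/DegreeLadder.lean`, which `Theorems/` cannot import; the two
spellings agree by `rfl`, so the skeleton closes its stub by `exact stub_cofactorShape`).

**Statement.**  Let `Λ : Fin r → ([n] ⊔ [n]) → ℤ` be ADMISSIBLE (zero row-sums and zero column-sums), `q ≠ 0` affine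
(`deg q ≤ 1`), and `B` a `T_Λ`-equivariant (exact lifts, `IsEquivariantDetRepr`) affine determinantal representation of
`per_n · q` (`n ≥ 1`).  Then `q` is a non-zero constant or a linear form (`IsHomogeneous 1`).

**Proof.**  Admissibility puts the homothety `x ↦ 2x` (`d ≡ 2`, `e ≡ 1`: `∏ d^{Λ_i} ∏ e^{Λ_i} = 2^{Σ_k Λ_i(k)} = 2⁰ = 1`) in `T_Λ`.
An exact lift `(g, h)` of it gives `(per_n · q)(2x) = det g · det h⁻¹ · (per_n · q)(x)` (`IsEquivariantDetRepr.linSubst_eq_smul`);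
`per_n(2x) = 2ⁿ per_n(x)` (`LRPencil.linSubst_diagonal_perPoly`) and `ℂ[x]` is a domain (`perPoly_ne_zero`), so `2ⁿ q(2x) = κ q(x)`.  Writing
`q = q₀ + q₁` (constant + linear part), `q(2x) = q₀ + 2 q₁`, and comparing constant terms and the rest: `2ⁿ q₀ = κ q₀`,
`2ⁿ⁺¹ q₁ = κ q₁`; if `q₀ ≠ 0` then `κ = 2ⁿ` and `q₁ = 0`, else `q = q₁` is a linear form.

HONEST FRAMING: ONE registered stub (size M) of a forward rung inside one route; the load-bearing stub `stub_absorbingSacrifice`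
and the crux `OrbitDimensionBound` (stmt-16133) stay OPEN; census-neutral; `VP ≠ VNP` is NOT proved and nothing here bears on it.
-/

set_option autoImplicit false

-- the mandated summit-side namespace repeats a component by design (single-problem summit)
set_option linter.dupNamespace false

noncomputable section

open Matrix MvPolynomial Finset
open scoped Kronecker
open Literature.Computability.AlgebraicComplexity LRPencil

namespace Summit.ValiantsHypothesis.ValiantsHypothesis.Theorems.FreeSubtorusOrbitDimensionBound

/-- The homothety `x ↦ 2·x` doubles a linear form `Σ_v a_v x_v`. -/
theorem linSubst_two_linear {n : ℕ} (a : Fin n × Fin n → ℂ) :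
    linSubst (Fin n × Fin n) ℂ (Matrix.diagonal (fun _ : Fin n => (2 : ℂ)) ⊗ₖ Matrix.diagonal (fun _ : Fin n => (1 : ℂ)))
        (∑ v, C (a v) * X v) = C 2 * ∑ v, C (a v) * X v := by
  classical
  have hX : ∀ v : Fin n × Fin n,
      linSubst (Fin n × Fin n) ℂ (Matrix.diagonal (fun _ : Fin n => (2 : ℂ)) ⊗ₖ Matrix.diagonal (fun _ : Fin n => (1 : ℂ)))
        (X v) = C 2 * X v := by
    intro v
    rw [linSubst_X, Matrix.diagonal_kronecker_diagonal, Finset.sum_eq_single v]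
    · rw [Matrix.diagonal_apply_eq, mul_one, MvPolynomial.smul_eq_C_mul]
    · intro j _ hj; rw [Matrix.diagonal_apply_ne _ hj, zero_smul]
    · intro h; exact absurd (Finset.mem_univ v) h
  rw [map_sum, Finset.mul_sum]
  refine Finset.sum_congr rfl fun v _ => ?_
  rw [map_mul, linSubst_C, hX]
  ring

/-- Integer powers of one unit multiply to the power of the sum (the homothety's membership in `T_Λ`). -/
theorem prod_zpow_eq_zpow_sum_units {ι : Type*} (s : Finset ι) (u : ℂˣ) (f : ι → ℤ) :
    ∏ k ∈ s, u ^ f k = u ^ ∑ k ∈ s, f k := by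
  classical
  induction s using Finset.induction_on with
  | empty => simp
  | insert a s ha ih => rw [Finset.prod_insert ha, Finset.sum_insert ha, ih, _root_.zpow_add]

/-- **Registered stub `stub_cofactorShape` of line `affine_multiple` (crux stmt-ValiantsHypothesis-16133): forced
semi-invariance of the cofactor.**  For admissible `Λ` (zero row- and column-sums), a non-zero affine `q` and a
`T_Λ`-equivariant (exact lifts) affine determinantal representation of `per_n · q` (`n ≥ 1`), the cofactor `q` is a non-zero
constant or a linear form.  (The homothety `x ↦ 2x` lies in `T_Λ`; `det`-equivariance and the domain `ℂ[x]` give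
`2ⁿ q(2x) = κ q(x)`; compare the constant and the linear part.)  Spelled over the inline form of `torusGen n r Λ` /
`Admissible n r Λ` (both `rfl`): the skeleton closes its registered `stub_cofactorShape` of `Lines/affine_multiple.lean` by `exact` (defeq wiring checked). [cite: LandsbergRessayre2017, §3, §6] -/
theorem stub_cofactorShape :
    ∀ (n m r : ℕ) (Λ : Fin r → (Fin n ⊕ Fin n) → ℤ) (B : Matrix (Fin m) (Fin m) (MvPolynomial (Fin n × Fin n) ℂ))
      (q : MvPolynomial (Fin n × Fin n) ℂ),
      1 ≤ n → (∀ i, (∑ k, Λ i (Sum.inl k)) = 0 ∧ (∑ l, Λ i (Sum.inr l)) = 0) → q ≠ 0 → q.totalDegree ≤ 1 →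
      IsEquivariantDetRepr (Subgroup.closure {γ : Matrix.GeneralLinearGroup (Fin n × Fin n) ℂ |
          ∃ d e : Fin n → ℂˣ, (∀ i, (∏ k, (d k) ^ (Λ i (Sum.inl k))) * (∏ l, (e l) ^ (Λ i (Sum.inr l))) = 1) ∧
            (γ : Matrix (Fin n × Fin n) (Fin n × Fin n) ℂ) = Matrix.diagonal (fun p => (d p.1 : ℂ) * (e p.2 : ℂ))})
        (perPoly (Fin n) ℂ * q) B →
      (∃ c : ℂ, c ≠ 0 ∧ q = C c) ∨ q.IsHomogeneous 1 := by
  intro n m r Λ B q hn hΛ hq0 hqd hB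
  classical
  -- (1) the homothety `x ↦ 2x` as an element of `T_Λ`
  set d : Fin n → ℂ := fun _ => 2 with hd
  set e : Fin n → ℂ := fun _ => 1 with he
  have hd0 : ∀ i, d i ≠ 0 := fun _ => two_ne_zero
  have he0 : ∀ i, e i ≠ 0 := fun _ => one_ne_zero
  let γ : GL (Fin n × Fin n) ℂ := Matrix.GeneralLinearGroup.kronecker (diagUnit ℂ d hd0) (diagUnit ℂ e he0)
  have hγcoe : (γ : Matrix (Fin n × Fin n) (Fin n × Fin n) ℂ) = Matrix.diagonal d ⊗ₖ Matrix.diagonal e :=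
    coe_kronecker_diagUnit d e hd0 he0
  have hγmem : γ ∈ Subgroup.closure {γ : Matrix.GeneralLinearGroup (Fin n × Fin n) ℂ |
      ∃ d e : Fin n → ℂˣ, (∀ i, (∏ k, (d k) ^ (Λ i (Sum.inl k))) * (∏ l, (e l) ^ (Λ i (Sum.inr l))) = 1) ∧
        (γ : Matrix (Fin n × Fin n) (Fin n × Fin n) ℂ) = Matrix.diagonal (fun p => (d p.1 : ℂ) * (e p.2 : ℂ))} := by
    refine Subgroup.subset_closure ⟨fun _ => Units.mk0 2 two_ne_zero, fun _ => 1, fun i => ?_, ?_⟩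
    · show (∏ k, (Units.mk0 (2 : ℂ) two_ne_zero) ^ Λ i (Sum.inl k)) * ∏ l, (1 : ℂˣ) ^ Λ i (Sum.inr l) = 1
      simp only [_root_.one_zpow, Finset.prod_const_one, mul_one]
      rw [prod_zpow_eq_zpow_sum_units, (hΛ i).1, zpow_zero]
    · rw [hγcoe, Matrix.diagonal_kronecker_diagonal]
      rfl
  -- (2) the affine decomposition `q = q₀ + L`, `L = Σ_v a_v x_v`
  set q₀ : ℂ := coeff 0 q with hq₀
  set L : MvPolynomial (Fin n × Fin n) ℂ := ∑ v, C (coeff (Finsupp.single v 1) q) * X v with hL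
  have hq : q = C q₀ + L := eq_affine_of_totalDegree_le_one q hqd
  have hLhom : L.IsHomogeneous 1 := IsHomogeneous.sum _ _ _ fun v _ => (isHomogeneous_X ℂ v).C_mul _
  have hL0 : coeff 0 L = 0 := hLhom.coeff_eq_zero (by simp)
  -- (3) the determinant identity of an exact lift: `(per · q)(2x) = κ · (per · q)(x)`
  obtain ⟨g, h, hdet⟩ := hB.linSubst_eq_smul hγmem
  set κ : ℂ := (g : Matrix (Fin m) (Fin m) ℂ).det * ((h⁻¹ : GL (Fin m) ℂ) : Matrix (Fin m) (Fin m) ℂ).det with hκ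
  rw [hγcoe, map_mul, linSubst_diagonal_perPoly, hq, map_add, linSubst_C, linSubst_two_linear] at hdet
  have h2n : ((∏ _k : Fin n, d _k) * ∏ _j : Fin n, e _j) = 2 ^ n := by
    simp [hd, he, Finset.prod_const, Finset.card_univ, Fintype.card_fin]
  rw [h2n] at hdet
  -- cancel `per_n` in the domain `ℂ[x]`: `2ⁿ (q₀ + 2 L) = κ (q₀ + L)`
  have hcancel : C (2 ^ n) * (C q₀ + C 2 * L) = C κ * (C q₀ + L) := by
    have h1 : perPoly (Fin n) ℂ * (C (2 ^ n) * (C q₀ + C 2 * L)) = perPoly (Fin n) ℂ * (C κ * (C q₀ + L)) := by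
      calc perPoly (Fin n) ℂ * (C (2 ^ n) * (C q₀ + C 2 * L))
          = C (2 ^ n) * perPoly (Fin n) ℂ * (C q₀ + C 2 * L) := by ring
        _ = C κ * (perPoly (Fin n) ℂ * (C q₀ + L)) := hdet
        _ = perPoly (Fin n) ℂ * (C κ * (C q₀ + L)) := by ring
    exact mul_left_cancel₀ (perPoly_ne_zero (Fin n) ℂ) h1
  -- constant terms: `2ⁿ q₀ = κ q₀`
  have hconst : 2 ^ n * q₀ = κ * q₀ := by
    have := congrArg (coeff 0) hcancel
    rw [mul_add, mul_add, coeff_add, coeff_add] at this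
    simp only [coeff_C_mul, coeff_zero_C, hL0, mul_zero, add_zero] at this
    exact this
  -- the rest: `(2ⁿ⁺¹ - κ) L = 0`
  have hlin : C (2 ^ n * 2 - κ) * L = 0 := by
    have h2 : C (2 ^ n) * (C q₀ + C 2 * L) - C κ * (C q₀ + L) =
        C (2 ^ n * q₀ - κ * q₀) + C (2 ^ n * 2 - κ) * L := by
      simp only [map_sub, map_mul]; ring
    have h1 : C (2 ^ n) * (C q₀ + C 2 * L) - C κ * (C q₀ + L) = 0 := by rw [hcancel, sub_self]
    rw [h2, hconst, sub_self, C_0, zero_add] at h1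
    exact h1
  by_cases hq00 : q₀ = 0
  · -- `q = L` is a linear form
    right
    rw [hq, hq00, C_0, zero_add]
    exact hLhom
  · -- `κ = 2ⁿ`, `L = 0`, `q` is the non-zero constant `q₀`
    left
    have hκ2 : κ = 2 ^ n := (mul_right_cancel₀ hq00 hconst).symm
    have hLz : L = 0 := by
      rw [hκ2] at hlin
      have hc : (2 : ℂ) ^ n * 2 - 2 ^ n ≠ 0 := by
        rw [show (2 : ℂ) ^ n * 2 - 2 ^ n = 2 ^ n by ring]; exact pow_ne_zero _ two_ne_zero
      rcases mul_eq_zero.1 hlin with h0 | h0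
      · exact absurd ((C_eq_zero).1 h0) hc
      · exact h0
    refine ⟨q₀, hq00, ?_⟩
    rw [hq, hLz, add_zero]

end Summit.ValiantsHypothesis.ValiantsHypothesis.Theorems.FreeSubtorusOrbitDimensionBound

end
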